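import Summits.HubbardSuperconductivity.HubbardSuperconductivity.Theorems.AnisotropyChordStiffnessFirstMoment

/-!
# Route `AnisotropyChord` / H0 rotor rung: the SCALE BOOKKEEPING (D5) of THEOREM TWIST-IR, PROVED —
# `KLipschitzDeficit ⟸ FirstMomentLocality ∧ KernelLipschitzAtScale` (theory seat memo ROTOR-THEORY-8 §120/§122;
# Sketch8 Part R ported)

Typed stub D4 `KernelLipschitzAtScale` (fixed-scale near/far split output), `scaleError` and its limit,
**`kLipschitzDeficit_of_scale`** (γ = 1/8, Ω = C|k|^{1/8}, R = |k|^{−1/4}), and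
**`eventualCondensate_of_locality_skeleton`**.  Typing authority: theory seat `hubbard-h0-rotor-theory-1`, cycle 8.
-/

set_option linter.dupNamespace false

noncomputable section

open Matrix Complex Finset Filter Topology MeasureTheory
open scoped ComplexConjugate
open Literature.MathematicalPhysics.QuantumLattice hiding torusPhase torusNorm
open Literature.Probability.LatticeModels
open Summit.HubbardSuperconductivity.HubbardSuperconductivity.Theorems.AnisotropyChord.InsertionEntropy

namespace Summit.HubbardSuperconductivity.HubbardSuperconductivity.Theorems.AnisotropyChord.Stiffness

/-- `|k|_T ≥ 2π/L` for `k ≠ 0`. [folklore] -/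
theorem two_pi_div_le_torusNorm (L : ℕ) [NeZero L] {k : TorusSite 2 L} (hk : k ≠ 0) :
    2 * Real.pi / (L : ℝ) ≤ torusNorm L k := by
  rw [torusNorm_eq]
  have hL : (0 : ℝ) < (L : ℝ) := by exact_mod_cast Nat.pos_of_ne_zero (NeZero.ne L)
  have h1 : (1 : ℝ) ≤ Real.sqrt (∑ i, (((k i).valMinAbs.natAbs : ℕ) : ℝ) ^ 2) := by
    rw [show (1 : ℝ) = Real.sqrt 1 by simp]
    exact Real.sqrt_le_sqrt (one_le_sum_natAbs_valMinAbs_sq hk)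
  calc 2 * Real.pi / (L : ℝ) = 2 * Real.pi / (L : ℝ) * 1 := by ring
    _ ≤ _ := mul_le_mul_of_nonneg_left h1 (by positivity)

/-- The filtered current form `G_Ω(k;ε) = Σᵢ g_Ω(ωᵢ)|Σⱼ εⱼ⟨vᵢ,Jʲ_kψ⟩|²`. -/
def filteredForm (L : ℕ) [NeZero L] (Δ M : ℝ) (a : (TorusSite 2 L → Fin 2) → ℝ) (Ω : ℝ)
    (k : TorusSite 2 L) (ε : Fin 2 → ℂ) : ℝ :=
  ∑ i, lorentzFilter Ω (excitation L Δ M i) * ‖∑ j, ε j * currentAmp L Δ a k j i‖ ^ 2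

/-- `G_Ω(k;ε) ≥ 0` for a sector state (no weight below the sector ground energy). -/
theorem filteredForm_nonneg (L : ℕ) [NeZero L] (Δ M : ℝ) (a : (TorusSite 2 L → Fin 2) → ℝ)
    (ha : IsPerronSectorGroundAmplitude L Δ M a) (Ω : ℝ) (k : TorusSite 2 L) (ε : Fin 2 → ℂ) :
    0 ≤ filteredForm L Δ M a Ω k ε := by
  have hmem : (∑ j, ε j • (currentMode L k j *ᵥ toC L a)) ∈
      spinZSector (Λ := TorusSite 2 L) 1 M :=
    Submodule.sum_mem _ fun j _ =>
      Submodule.smul_mem _ _ (currentMode_mulVec_mem_spinZSector L k j M ha.sector)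
  unfold filteredForm
  refine Finset.sum_nonneg fun i _ => ?_
  rcases lt_or_ge (excitation L Δ M i) 0 with hlt | hge
  · have h0 : ∑ j, ε j * currentAmp L Δ a k j i = 0 := by
      rw [sum_currentAmp_eq, sectorVanishing L Δ M hmem i hlt]
    rw [h0, norm_zero]
    simp
  · exact mul_nonneg (by unfold lorentzFilter; positivity) (sq_nonneg _)

/-- **STUB D4 — KERNEL LIPSCHITZ AT SCALE `(Ω, R)`** (near/far split of `filteredForm_eq_kernel_sum`: kernel sup bound
`filteredKernel_lattice_norm_le` and `|e^{ik·Δ} − 1| ≤ √2|k|_T d_∞(Δ)` for the `O(L²R²)` pairs at distance `≤ R`; K2+K3 and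
`Σ_{r>R} 8r e^{−ar}` for the rest).  Pure locality + time reversal; size M. -/
def KernelLipschitzAtScale (Δ : ℝ) (M : ℕ → ℝ) : Prop :=
  ∃ A : ℝ, 0 < A ∧ ∃ v : ℝ, 0 < v ∧ ∃ μ : ℝ, 0 < μ ∧
    ∀ᶠ L : ℕ in atTop, ∀ [NeZero L],
    ∀ a : (TorusSite 2 L → Fin 2) → ℝ, IsPerronSectorGroundAmplitude L Δ (M L - 1) a →
    ∀ (k : TorusSite 2 L) (ε : Fin 2 → ℂ) (Ω : ℝ), 0 < Ω → ∀ R : ℝ, 1 ≤ R → 4 * R ≤ (L : ℝ) →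
      filteredForm L Δ (M L - 1) a Ω k ε ≤ filteredForm L Δ (M L - 1) a Ω 0 ε
        + (L : ℝ) ^ 2 * (∑ j, ‖ε j‖ ^ 2) * (A * (torusNorm L k * R ^ 3 / Ω
            + ((R + 1) / Ω + R / Ω ^ 2 + 1 / Ω ^ 3) * Real.exp (-(Ω * R / v))
            + (R + 1) / Ω * Real.exp (-(μ * R))))

/-- The error at the chosen scales as a function of `u = |k|^{−1/8}` alone (`C = 1` envelope). -/
def scaleError (A v μ u : ℝ) : ℝ :=
  A * (1 / u + (u ^ 3 + u + u ^ 4 + u ^ 3) * Real.exp (-(u / v)) + (u ^ 3 + u) * Real.exp (-(μ * u)))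

/-- `scaleError A v μ u → 0` as `u → ∞` (power times decaying exponentials). -/
theorem tendsto_scaleError (A v μ : ℝ) (hv : 0 < v) (hμ : 0 < μ) :
    Tendsto (scaleError A v μ) atTop (𝓝 0) := by
  have h1 : Tendsto (fun u : ℝ => 1 / u) atTop (𝓝 0) := by
    simpa only [one_div] using tendsto_inv_atTop_zero
  have hpe : ∀ (n : ℕ) (b : ℝ), 0 < b →
      Tendsto (fun u : ℝ => u ^ n * Real.exp (-(b * u))) atTop (𝓝 0) := by
    intro n b hb
    have h := tendsto_rpow_mul_exp_neg_mul_atTop_nhds_zero (n : ℝ) b hb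
    refine h.congr' ?_
    filter_upwards with u
    rw [Real.rpow_natCast, neg_mul]
  have h2 : Tendsto (fun u : ℝ => (u ^ 3 + u + u ^ 4 + u ^ 3) * Real.exp (-(u / v))) atTop (𝓝 0) := by
    have h4 := hpe 4 (1 / v) (by positivity)
    have h3 := hpe 3 (1 / v) (by positivity)
    have h1 := hpe 1 (1 / v) (by positivity)
    have := ((h3.add h1).add h4).add h3
    rw [add_zero, add_zero, add_zero] at this
    refine this.congr' ?_
    filter_upwards with u
    rw [show 1 / v * u = u / v by ring]
    ring
  have h3 : Tendsto (fun u : ℝ => (u ^ 3 + u) * Real.exp (-(μ * u))) atTop (𝓝 0) := by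
    have h3' := hpe 3 μ hμ
    have h1' := hpe 1 μ hμ
    have := h3'.add h1'
    rw [add_zero] at this
    refine this.congr' ?_
    filter_upwards with u
    ring
  have := ((h1.add h2).add h3).const_mul A
  rw [add_zero, add_zero, mul_zero] at this
  exact this

/-- The fixed-scale error at `Ω = C/u`, `R = u²` (`C ≥ 1`, `u ≥ 1`, `|k|u⁸ = 1`) is below the `C = 1` envelope. -/
theorem scaleError_bound (A v μ C u κ : ℝ) (hA : 0 ≤ A) (hv : 0 < v) (hμ : 0 < μ) (hC : 1 ≤ C)
    (hu : 1 ≤ u) (hκ : 0 < κ) (hκu : κ * u ^ 8 = 1) :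
    A * (κ * (u ^ 2) ^ 3 / (C / u)
        + ((u ^ 2 + 1) / (C / u) + (u ^ 2) / (C / u) ^ 2 + 1 / (C / u) ^ 3) * Real.exp (-(C / u * u ^ 2 / v))
        + (u ^ 2 + 1) / (C / u) * Real.exp (-(μ * u ^ 2)))
      ≤ scaleError A v μ u := by
  unfold scaleError
  have hu0 : 0 < u := by linarith
  have hC0 : 0 < C := by linarith
  refine mul_le_mul_of_nonneg_left ?_ hA
  have e1 : κ * (u ^ 2) ^ 3 / (C / u) = 1 / u * (1 / C) := by
    have : κ * u ^ 7 = 1 / u := by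
      field_simp
      linear_combination hκu
    rw [show κ * (u ^ 2) ^ 3 / (C / u) = κ * u ^ 7 / C by field_simp, this]
    ring
  have t1 : κ * (u ^ 2) ^ 3 / (C / u) ≤ 1 / u := by
    rw [e1]
    have : 1 / C ≤ 1 := by rw [div_le_one hC0]; exact hC
    calc 1 / u * (1 / C) ≤ 1 / u * 1 := mul_le_mul_of_nonneg_left this (by positivity)
      _ = 1 / u := mul_one _
  have t2a : (u ^ 2 + 1) / (C / u) + (u ^ 2) / (C / u) ^ 2 + 1 / (C / u) ^ 3
      ≤ u ^ 3 + u + u ^ 4 + u ^ 3 := by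
    have h0 : (u ^ 2 + 1) / (C / u) = (u ^ 3 + u) / C := by field_simp
    have ha : (u ^ 2) / (C / u) ^ 2 = u ^ 4 / C ^ 2 := by field_simp
    have hb : 1 / (C / u) ^ 3 = u ^ 3 / C ^ 3 := by field_simp
    rw [h0, ha, hb]
    have hC2 : 1 ≤ C ^ 2 := by nlinarith
    have hC3 : 1 ≤ C ^ 3 := by nlinarith
    exact add_le_add (add_le_add (div_le_self (by positivity) hC) (div_le_self (by positivity) hC2))
      (div_le_self (by positivity) hC3)
  have t2b : Real.exp (-(C / u * u ^ 2 / v)) ≤ Real.exp (-(u / v)) := by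
    rw [Real.exp_le_exp, neg_le_neg_iff]
    rw [show C / u * u ^ 2 / v = C * (u / v) by field_simp]
    have : 0 ≤ u / v := by positivity
    nlinarith
  have t3a : (u ^ 2 + 1) / (C / u) ≤ u ^ 3 + u := by
    rw [show (u ^ 2 + 1) / (C / u) = (u ^ 3 + u) / C by field_simp]
    exact div_le_self (by positivity) hC
  have t3b : Real.exp (-(μ * u ^ 2)) ≤ Real.exp (-(μ * u)) := by
    rw [Real.exp_le_exp, neg_le_neg_iff]
    have : u ≤ u ^ 2 := by nlinarith
    exact mul_le_mul_of_nonneg_left this hμ.le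
  have p2 : 0 ≤ (u ^ 2 + 1) / (C / u) + (u ^ 2) / (C / u) ^ 2 + 1 / (C / u) ^ 3 := by positivity
  have p3 : 0 ≤ (u ^ 2 + 1) / (C / u) := by positivity
  refine add_le_add (add_le_add t1 ?_) ?_
  · exact mul_le_mul t2a t2b (Real.exp_pos _).le (by positivity)
  · exact mul_le_mul t3a t3b (Real.exp_pos _).le (by positivity)

set_option maxHeartbeats 400000 in
/-- **D5 PROVED — SCALE BOOKKEEPING: `FirstMomentLocality ∧ KernelLipschitzAtScale ⇒ KLipschitzDeficit`.**
Choices: `γ = 1/8`, `u = |k|^{−1/8}`, `Ω = C|k|^{1/8} = C/u`, `R = u²`; `u₀(η)` from `tendsto_scaleError`, then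
`C = max 1 (u₀ √(2C_J/η))`; `|k|` small (`u > u₀`): D4 + `scaleError_bound`; `|k|` large (`u ≤ u₀`): first moment. -/
theorem kLipschitzDeficit_of_scale (Δ : ℝ) (M : ℕ → ℝ) (hK1 : FirstMomentLocality Δ M)
    (hD4 : KernelLipschitzAtScale Δ M) : KLipschitzDeficit Δ M := by
  intro η hη
  obtain ⟨CJ, hCJ, hK1ev⟩ := hK1
  obtain ⟨A, hA, v, hv, μ, hμ, hD4ev⟩ := hD4
  have hlim := tendsto_scaleError A v μ hv hμ
  have hev : ∀ᶠ u in atTop, scaleError A v μ u < η / 2 :=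
    hlim.eventually (gt_mem_nhds (by positivity))
  obtain ⟨u₁, hu₁⟩ := Filter.eventually_atTop.1 hev
  set u₀ : ℝ := max u₁ 1 with hu₀def
  have hu₀1 : 1 ≤ u₀ := le_max_right _ _
  have hu₀0 : 0 < u₀ := by linarith
  have hsmall : ∀ u, u₀ ≤ u → scaleError A v μ u < η / 2 :=
    fun u hu => hu₁ u ((le_max_left _ _).trans hu)
  set C : ℝ := max 1 (u₀ * Real.sqrt (2 * CJ / η)) with hCdef
  have hC1 : 1 ≤ C := le_max_left _ _
  have hC0 : 0 < C := by linarith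
  have hCsq : u₀ ^ 2 * (2 * CJ / η) ≤ C ^ 2 := by
    have h1 : u₀ * Real.sqrt (2 * CJ / η) ≤ C := le_max_right _ _
    have h2 : 0 ≤ u₀ * Real.sqrt (2 * CJ / η) := by positivity
    calc u₀ ^ 2 * (2 * CJ / η) = (u₀ * Real.sqrt (2 * CJ / η)) ^ 2 := by
          rw [mul_pow, Real.sq_sqrt (by positivity)]
      _ ≤ C ^ 2 := pow_le_pow_left₀ h2 h1 2
  refine ⟨1 / 8, by norm_num, by norm_num, C, hC0, ?_⟩
  filter_upwards [hK1ev, hD4ev] with L hK1L hD4L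
  intro _inst a ha k hk ε
  have hLpos : (0 : ℝ) < (L : ℝ) := by exact_mod_cast Nat.pos_of_ne_zero (NeZero.ne L)
  have hκ : 0 < torusNorm L k := torusNorm_pos hk
  have hκL : 2 * Real.pi / (L : ℝ) ≤ torusNorm L k := two_pi_div_le_torusNorm L hk
  obtain ⟨u, hudef⟩ : ∃ u : ℝ, u = torusNorm L k ^ (-(1 / 8 : ℝ)) := ⟨_, rfl⟩
  have hu0 : 0 < u := by rw [hudef]; exact Real.rpow_pos_of_pos hκ _
  have hΩu : C * torusNorm L k ^ (1 / 8 : ℝ) = C / u := by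
    rw [hudef, Real.rpow_neg hκ.le, div_inv_eq_mul]
  have hΩ0 : 0 < C / u := div_pos hC0 hu0
  have hκu8 : torusNorm L k * u ^ 8 = 1 := by
    rw [hudef, ← Real.rpow_natCast, ← Real.rpow_mul hκ.le]
    norm_num
    rw [Real.rpow_neg_one, mul_inv_cancel₀ hκ.ne']
  show filteredForm L Δ (M L - 1) a (C * torusNorm L k ^ (1 / 8 : ℝ)) k ε
      ≤ filteredForm L Δ (M L - 1) a (C * torusNorm L k ^ (1 / 8 : ℝ)) 0 ε + η * (L : ℝ) ^ 2 * ∑ j, ‖ε j‖ ^ 2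
  rw [hΩu]
  have hG0 : 0 ≤ filteredForm L Δ (M L - 1) a (C / u) 0 ε :=
    filteredForm_nonneg L Δ (M L - 1) a ha _ 0 ε
  have hE : 0 ≤ (L : ℝ) ^ 2 * ∑ j, ‖ε j‖ ^ 2 := by positivity
  rcases lt_or_ge u₀ u with hlarge_u | hsmall_u
  · -- small |k| : u > u₀ ≥ 1; D4 at Ω = C/u, R = u²
    have hu1 : 1 ≤ u := hu₀1.trans hlarge_u.le
    have h8 : (1 : ℝ) ≤ u ^ 8 := one_le_pow₀ hu1
    have hκeq : torusNorm L k = 1 / u ^ 8 := by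
      field_simp
      linear_combination hκu8
    have hκ1 : torusNorm L k ≤ 1 := by
      rw [hκeq, div_le_one (by positivity)]
      exact h8
    have hR1 : (1 : ℝ) ≤ u ^ 2 := one_le_pow₀ hu1
    have hu2 : u ^ 2 = torusNorm L k ^ (-(1 / 4 : ℝ)) := by
      rw [hudef, ← Real.rpow_natCast, ← Real.rpow_mul hκ.le]
      norm_num
    have hu2le : u ^ 2 ≤ (torusNorm L k)⁻¹ := by
      rw [hu2, ← Real.rpow_neg_one]
      exact Real.rpow_le_rpow_of_exponent_ge hκ hκ1 (by norm_num)
    have hκinv : (torusNorm L k)⁻¹ ≤ (L : ℝ) / (2 * Real.pi) := by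
      have := inv_anti₀ (by positivity : 0 < 2 * Real.pi / (L : ℝ)) hκL
      rwa [inv_div] at this
    have hpi : (L : ℝ) / (2 * Real.pi) ≤ (L : ℝ) / 4 := by
      apply div_le_div_of_nonneg_left hLpos.le (by norm_num)
      linarith [Real.pi_gt_three]
    have hR4 : 4 * u ^ 2 ≤ (L : ℝ) := by linarith
    have hmain := hD4L a ha k ε (C / u) hΩ0 (u ^ 2) hR1 hR4
    have hbound := scaleError_bound A v μ C u (torusNorm L k) hA.le hv hμ hC1 hu1 hκ hκu8
    have hsm := hsmall u hlarge_u.le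
    have hEη : 0 ≤ ((L : ℝ) ^ 2 * ∑ j, ‖ε j‖ ^ 2) * η := mul_nonneg hE hη.le
    have herr : (L : ℝ) ^ 2 * (∑ j, ‖ε j‖ ^ 2) * (A * (torusNorm L k * (u ^ 2) ^ 3 / (C / u)
        + ((u ^ 2 + 1) / (C / u) + (u ^ 2) / (C / u) ^ 2 + 1 / (C / u) ^ 3) * Real.exp (-(C / u * u ^ 2 / v))
        + (u ^ 2 + 1) / (C / u) * Real.exp (-(μ * u ^ 2))))
        ≤ (L : ℝ) ^ 2 * (∑ j, ‖ε j‖ ^ 2) * scaleError A v μ u :=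
      mul_le_mul_of_nonneg_left hbound hE
    calc filteredForm L Δ (M L - 1) a (C / u) k ε
        ≤ filteredForm L Δ (M L - 1) a (C / u) 0 ε
          + (L : ℝ) ^ 2 * (∑ j, ‖ε j‖ ^ 2) * scaleError A v μ u := by
          linarith [hmain, herr]
      _ ≤ filteredForm L Δ (M L - 1) a (C / u) 0 ε + (L : ℝ) ^ 2 * (∑ j, ‖ε j‖ ^ 2) * (η / 2) := by
          linarith [mul_le_mul_of_nonneg_left hsm.le hE]
      _ ≤ filteredForm L Δ (M L - 1) a (C / u) 0 ε + η * (L : ℝ) ^ 2 * ∑ j, ‖ε j‖ ^ 2 := by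
          linarith
  · -- large |k| : u ≤ u₀; first moment
    have hfm := filtered_le_firstMoment L Δ (M L - 1) a ha k ε (C / u) hΩ0
    have hm1 := hK1L a ha k ε
    have hΩinv : 1 / (C / u) ^ 2 ≤ u₀ ^ 2 / C ^ 2 := by
      rw [show 1 / (C / u) ^ 2 = u ^ 2 / C ^ 2 by field_simp]
      exact div_le_div_of_nonneg_right (pow_le_pow_left₀ hu0.le hsmall_u 2) (by positivity)
    have hcoef : u₀ ^ 2 / C ^ 2 * CJ ≤ η / 2 := by
      rw [div_mul_eq_mul_div, div_le_iff₀ (by positivity)]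
      have : u₀ ^ 2 * (2 * CJ / η) * η ≤ C ^ 2 * η := mul_le_mul_of_nonneg_right hCsq hη.le
      have e : u₀ ^ 2 * (2 * CJ / η) * η = 2 * (u₀ ^ 2 * CJ) := by field_simp
      nlinarith
    have hEC : 0 ≤ CJ * (L : ℝ) ^ 2 * ∑ j, ‖ε j‖ ^ 2 := by positivity
    calc filteredForm L Δ (M L - 1) a (C / u) k ε
        ≤ 1 / (C / u) ^ 2 * ∑ i, excitation L Δ (M L - 1) i * ‖∑ j, ε j * currentAmp L Δ a k j i‖ ^ 2 :=
          hfm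
      _ ≤ 1 / (C / u) ^ 2 * (CJ * (L : ℝ) ^ 2 * ∑ j, ‖ε j‖ ^ 2) :=
          mul_le_mul_of_nonneg_left hm1 (by positivity)
      _ ≤ u₀ ^ 2 / C ^ 2 * (CJ * (L : ℝ) ^ 2 * ∑ j, ‖ε j‖ ^ 2) :=
          mul_le_mul_of_nonneg_right hΩinv hEC
      _ = (u₀ ^ 2 / C ^ 2 * CJ) * ((L : ℝ) ^ 2 * ∑ j, ‖ε j‖ ^ 2) := by ring
      _ ≤ (η / 2) * ((L : ℝ) ^ 2 * ∑ j, ‖ε j‖ ^ 2) := mul_le_mul_of_nonneg_right hcoef hE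
      _ ≤ filteredForm L Δ (M L - 1) a (C / u) 0 ε + η * (L : ℝ) ^ 2 * ∑ j, ‖ε j‖ ^ 2 := by
          have hEη : 0 ≤ ((L : ℝ) ^ 2 * ∑ j, ‖ε j‖ ^ 2) * η := mul_nonneg hE hη.le
          linarith

/-- **KERNEL-CHECKED END-TO-END SKELETON v8 (memo §122)**: every remaining input is a typed, H0-hypothesis-free stub
(`LatticeFSumRule`, `ContinuityEquation`, `DoubleCommutatorBound` K1′, `KernelLipschitzAtScale` D4) or one of the three
physical hypotheses (`GaussianInsertionComparison` H1′, `UniformHelicityTensor` S_Υ, `StructureFactorUpper` S_max). -/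
theorem eventualCondensate_of_locality_skeleton (Δ : ℝ) (M : ℕ → ℝ) (ρ : ℝ) (hρ : ρ ∈ Set.Ioo (0 : ℝ) 1)
    (hlim : Tendsto (fun L : ℕ => 1 / 2 + M L / (L : ℝ) ^ 2) atTop (nhds ρ))
    (hsect : ∀ᶠ L : ℕ in atTop, ∀ [NeZero L], spinZSector (Λ := TorusSite 2 L) 1 (M L - 1) ≠ ⊥)
    (hF : LatticeFSumRule Δ) (hC : ContinuityEquation)
    (hK1 : DoubleCommutatorBound Δ M) (hD4 : KernelLipschitzAtScale Δ M)
    (hG : GaussianInsertionComparison Δ M) (hU : UniformHelicityTensor Δ M)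
    (hSmax : StructureFactorUpper Δ M) : EventualCondensate Δ M :=
  eventualCondensate_of_helicity_skeleton Δ M ρ hρ hlim hsect hF hC
    (kLipschitzDeficit_of_scale Δ M (firstMomentLocality_of_doubleComm Δ M hK1) hD4) hG hU hSmax


end Summit.HubbardSuperconductivity.HubbardSuperconductivity.Theorems.AnisotropyChord.Stiffness
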